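import Summits.AnomalousDissipation.AnomalousDissipation.Theorems.MarginalStabilityChainBurgersLayerKHLine
import Summits.AnomalousDissipation.AnomalousDissipation.Theorems.MarginalStabilityChainBurgersLayerKHStubResolventUniqueB

/-!
# Stub `stub_resolventUnique` of the line `Sketch` (crux stmt-AnomalousDissipation-3008):
# uniqueness of the Gaussian-class resolvent of `λ + iU − h·OU`

Registered stub (line `Sketch`, vocabulary of `MarginalStabilityChainBurgersLayerKHLine.lean`):

  `theorem stub_resolventUnique :
     ∀ α : ℝ, 0 < α → α ≤ 1 → ∀ lam : ℂ, 0 < lam.re → ∀ h : ℝ, 0 < h → ResolventUniqueAt α h lam`,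

i.e. a `C²` solution `ω` of the HOMOGENEOUS resolvent equation
`(λ + iU(y)) ω − h (ω'' + y ω' + (1 − α²) ω) = 0` on `ℝ` in the Gaussian class `‖ω y‖ ≤ C e^{−y²/4}`
vanishes identically, for `re λ > 0`, `h > 0`, `α ∈ (0, 1]`.

Proof (Gaussian conjugation + Weber energy lemma).  Put `W := e^{y²/4} ω`; then `W` is twice
differentiable and BOUNDED (`‖W‖ ≤ C`), and since `ω'' + yω' + ω = e^{−y²/4} (W'' + (½ − y²/4) W)` the
equation becomes the Weber-type equation

  `W'' = ( y²/4 + μ + i ν(y) ) W`,  `μ := re λ / h + α² − ½ > −½`,  `ν(y) := (im λ + U(y)) / h` (real),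

whose bounded solutions vanish by the Weber energy lemma `weber_complex` of part B (energy identity +
Hermite ground-state bound `½`; transplanted from §0 of `Cruxes/BurgersLayerKH/Disproof.lean`).  Hence
`W ≡ 0` and `ω = e^{−y²/4} W ≡ 0`.  The hypotheses `α ≤ 1` and `re λ > 0` are used only through
`μ > −½` (in fact `μ > α² − ½ ≥ −½` would need only `re λ ≥ 0`, `α > 0`).  Pure proof file.
-/

-- `Summit.<Summit>.<Problem>` is the tree's mandated summit-side namespace (CONVENTIONS §2); for this
-- single-conjunct summit the two coincide, so the duplicate is deliberate.
set_option linter.dupNamespace false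

noncomputable section

open Complex MeasureTheory Filter Topology Set Metric

namespace Summit.AnomalousDissipation.AnomalousDissipation.Theorems.BurgersLayerKH.Sheet.ResolventUnique

/-- **Gaussian conjugation.** If `ω ∈ C²(ℝ)` satisfies the homogeneous resolvent equation
`(λ + iU) ω = h (ω'' + y ω' + (1 − α²) ω)` with `‖ω y‖ ≤ C e^{−y²/4}`, `h > 0`, `re λ > 0`, then `ω ≡ 0`:
`W = e^{y²/4} ω` is a bounded solution of `W'' = (y²/4 + μ + iν(y)) W` with
`μ = re λ/h + α² − ½ > −½`, `ν = (im λ + U)/h`, and the Weber energy lemma applies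
(pattern of `re_le_of_noCoupling` in `Cruxes/BurgersLayerKH/Disproof.lean`). [folklore] -/
theorem eq_zero_of_isResolventSol {α h : ℝ} {lam : ℂ} (hlam : 0 < lam.re) (hh : 0 < h) {ω : ℝ → ℂ}
    (hω : IsResolventSol α h lam (fun _ => 0) ω) (y₀ : ℝ) : ω y₀ = 0 := by
  obtain ⟨hω2, ⟨C, hdecay⟩, hsol⟩ := hω
  -- regularity of ω
  have hωd : Differentiable ℝ ω := hω2.differentiable (by norm_num)
  have hω1d : Differentiable ℝ (deriv ω) := by
    have := hω2.differentiable_iteratedDeriv 1 (by norm_num)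
    simpa [iteratedDeriv_one] using this
  have hD : ∀ y, HasDerivAt ω (deriv ω y) y := fun y => (hωd y).hasDerivAt
  have hD1 : ∀ y, HasDerivAt (deriv ω) (deriv (deriv ω) y) y := fun y => (hω1d y).hasDerivAt
  have hit : ∀ y, iteratedDeriv 2 ω y = deriv (deriv ω) y := fun y => by
    rw [iteratedDeriv_succ, iteratedDeriv_one]
  -- the equation with `ω''` written as `deriv (deriv ω)`
  have heq : ∀ y : ℝ, (lam + I * (U y : ℂ)) * ω y
      - (h : ℂ) * (deriv (deriv ω) y + (y : ℂ) * deriv ω y + (1 - (α : ℂ) ^ 2) * ω y) = 0 := by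
    intro y
    have e := hsol y
    simp only [ou, hit y] at e
    exact e
  -- the Gaussian conjugation `W = e^{y²/4} ω`
  set E : ℝ → ℂ := fun y => ((Real.exp (y ^ 2 / 4) : ℝ) : ℂ) with hE_def
  have hEd : ∀ y : ℝ, HasDerivAt E ((y : ℂ) / 2 * E y) y := by
    intro y
    have h1 : HasDerivAt (fun x : ℝ => Real.exp (x ^ 2 / 4)) (Real.exp (y ^ 2 / 4) * (2 * y / 4)) y := by
      have := ((hasDerivAt_pow 2 y).div_const 4).exp
      refine this.congr_deriv ?_
      simp
    have h2 := h1.ofReal_comp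
    rw [hE_def]
    refine h2.congr_deriv ?_
    push_cast; ring
  set W : ℝ → ℂ := fun y => E y * ω y with hW_def
  set W₁ : ℝ → ℂ := fun y => E y * ((y : ℂ) / 2 * ω y + deriv ω y) with hW₁_def
  set W₂ : ℝ → ℂ := fun y => E y * ((y : ℂ) / 2 * ((y : ℂ) / 2 * ω y + deriv ω y)
    + ((1 : ℂ) / 2 * ω y + (y : ℂ) / 2 * deriv ω y + deriv (deriv ω) y)) with hW₂_def
  have hW : ∀ y, HasDerivAt W (W₁ y) y := by
    intro y
    rw [hW_def, hW₁_def]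
    exact ((hEd y).fun_mul (hD y)).congr_deriv (by ring)
  have hid : ∀ y : ℝ, HasDerivAt (fun x : ℝ => (x : ℂ) / 2) ((1 : ℂ) / 2) y := by
    intro y
    have := ((hasDerivAt_id' y).ofReal_comp).div_const (2 : ℂ)
    refine this.congr_deriv ?_
    simp
  have hW₁ : ∀ y, HasDerivAt W₁ (W₂ y) y := by
    intro y
    rw [hW₁_def, hW₂_def]
    exact ((hEd y).fun_mul (((hid y).fun_mul (hD y)).fun_add (hD1 y))).congr_deriv (by ring)
  have hWb : ∀ y, ‖W y‖ ≤ C := by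
    intro y
    have hE : ‖E y‖ = Real.exp (y ^ 2 / 4) := by
      simp only [hE_def, Complex.norm_real, Real.norm_eq_abs, abs_of_pos (Real.exp_pos _)]
    have h1 : ‖W y‖ = Real.exp (y ^ 2 / 4) * ‖ω y‖ := by
      simp only [hW_def, norm_mul, hE]
    rw [h1]
    have h2 := mul_le_mul_of_nonneg_left (hdecay y) (Real.exp_pos (y ^ 2 / 4)).le
    have h3 : Real.exp (y ^ 2 / 4) * (C * Real.exp (-(y ^ 2) / 4)) = C := by
      rw [mul_comm, mul_assoc, ← Real.exp_add]
      have : -(y ^ 2) / 4 + y ^ 2 / 4 = 0 := by ring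
      rw [this, Real.exp_zero, mul_one]
    linarith
  -- the conjugated (Weber-type) equation
  have hh0 : (h : ℂ) ≠ 0 := by exact_mod_cast hh.ne'
  set μ : ℝ := lam.re / h + α ^ 2 - 1 / 2 with hμ_def
  have hμ : -1 / 2 < μ := by
    have : 0 < lam.re / h := div_pos hlam hh
    rw [hμ_def]
    nlinarith [sq_nonneg α]
  have hμh : (μ : ℂ) * (h : ℂ) = (lam.re : ℂ) + ((α : ℂ) ^ 2 - 1 / 2) * (h : ℂ) := by
    have e : (lam.re : ℂ) / (h : ℂ) * (h : ℂ) = lam.re := div_mul_cancel₀ _ hh0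
    rw [hμ_def]
    push_cast
    linear_combination e
  have hνh : ∀ y : ℝ, (((lam.im + U y) / h : ℝ) : ℂ) * (h : ℂ) = (lam.im : ℂ) + (U y : ℂ) := by
    intro y
    push_cast
    exact div_mul_cancel₀ _ hh0
  have hWeq : ∀ y, W₂ y
      = ((y : ℂ) ^ 2 / 4 + (μ : ℂ) + Complex.I * (((lam.im + U y) / h : ℝ) : ℂ)) * W y := by
    intro y
    apply mul_left_cancel₀ hh0
    have h1 := heq y
    simp only [hW₂_def, hW_def]
    linear_combination (-(E y)) * h1 + (-(E y * ω y)) * hμh + (-(I * E y * ω y)) * hνh y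
      + (-(E y * ω y)) * Complex.re_add_im lam
  have hW0 := weber_complex (fun y => (lam.im + U y) / h) hW hW₁ hWb hWeq hμ y₀
  have hE0 : E y₀ ≠ 0 := by
    simp only [hE_def, ne_eq, Complex.ofReal_eq_zero]
    exact (Real.exp_pos _).ne'
  simp only [hW_def, mul_eq_zero] at hW0
  rcases hW0 with e | e
  · exact absurd e hE0
  · exact e

/-- **Registered stub `stub_resolventUnique`** (line `Sketch`): uniqueness of the Gaussian-class resolvent
of `λ + iU − h·OU` for `α ∈ (0,1]`, `re λ > 0`, `h > 0` — a Gaussian-class `C²` solution of the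
homogeneous resolvent equation vanishes (Gaussian conjugation `W = e^{y²/4} ω` + Weber energy lemma,
`μ = re λ/h + α² − ½ > −½`). [folklore] -/
theorem stub_resolventUnique : ∀ α : ℝ, 0 < α → α ≤ 1 → ∀ lam : ℂ, 0 < lam.re → ∀ h : ℝ, 0 < h → ResolventUniqueAt α h lam :=
  fun _α _hα _hα1 _lam hlam _h hh _ω hω y => eq_zero_of_isResolventSol hlam hh hω y

end Summit.AnomalousDissipation.AnomalousDissipation.Theorems.BurgersLayerKH.Sheet.ResolventUnique

end
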